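import Summits.CriticalPhenomena.PercolationContinuityZ3.Theorems.Transplant.PlanarSkeletonFrmQuasiDefs
import Summits.CriticalPhenomena.PercolationContinuityZ3.Theorems.Transplant.SkelFrmQuasiBChoiceRootReadX
import Summits.CriticalPhenomena.PercolationContinuityZ3.Theorems.Transplant.SkelFrmBChoiceRootReadX
import Summits.CriticalPhenomena.PercolationContinuityZ3.Theorems.Transplant.SkelFrmQuasiBChoiceRootBoxY2
import Summits.CriticalPhenomena.PercolationContinuityZ3.Theorems.Transplant.SkelFrmBChoiceRootBoxY2
import Summits.CriticalPhenomena.PercolationContinuityZ3.Theorems.Transplant.SkelPhiCorridorKGYPrism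
import Summits.CriticalPhenomena.PercolationContinuityZ3.Theorems.Transplant.SkelFrmQuasi1ChoiceDefs
import Summits.CriticalPhenomena.PercolationContinuityZ3.Theorems.Transplant.SkelFrmQuasi1ParamsLBL
import Summits.CriticalPhenomena.PercolationContinuityZ3.Theorems.Transplant.SkelFrmQuasi1ParamsPO
import Summits.CriticalPhenomena.PercolationContinuityZ3.Theorems.Transplant.SkelFrmQuasiBChoiceDefsT
import Summits.CriticalPhenomena.PercolationContinuityZ3.Theorems.Transplant.SkelFrmQuasiBChoiceNums
import Summits.CriticalPhenomena.PercolationContinuityZ3.Theorems.Transplant.SkelFrmQuasiBChoiceReadings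
import Summits.CriticalPhenomena.PercolationContinuityZ3.Theorems.Transplant.SkelFrmQuasiBChoiceRootBoxY
import Summits.CriticalPhenomena.PercolationContinuityZ3.Theorems.Transplant.SkelFrmQuasiBChoiceRootLanding
import Summits.CriticalPhenomena.PercolationContinuityZ3.Theorems.Transplant.SkelFrmQuasiBChoiceRootLanding2
import Summits.CriticalPhenomena.PercolationContinuityZ3.Theorems.Transplant.SkelFrmQuasiBChoiceRootRun
import Summits.CriticalPhenomena.PercolationContinuityZ3.Theorems.Transplant.SkelFrmQuasiBChoiceRootRunY
import Summits.CriticalPhenomena.PercolationContinuityZ3.Theorems.Transplant.SkelFrmQuasiBParamsBridge0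
import Summits.CriticalPhenomena.PercolationContinuityZ3.Theorems.Transplant.SkelFrmQuasiBParamsCorrKG
import Summits.CriticalPhenomena.PercolationContinuityZ3.Theorems.Transplant.SkelFrmQuasiBParamsCorrKG0
import Summits.CriticalPhenomena.PercolationContinuityZ3.Theorems.Transplant.SkelFrmQuasiBParamsCorrKGLen3
import Summits.CriticalPhenomena.PercolationContinuityZ3.Theorems.Transplant.SkelFrmQuasiBParamsLF
import Summits.CriticalPhenomena.PercolationContinuityZ3.Theorems.Transplant.SkelFrmQuasiBParamsLFA
import Summits.CriticalPhenomena.PercolationContinuityZ3.Theorems.Transplant.SkelFrmQuasiBParamsSchedA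
import HarnessLib
import Summits.CriticalPhenomena.PercolationContinuityZ3.Theorems.Transplant.SkelFrmBChoiceRootReadY
/-!
# GEN-Q PORT (WAVE-Q table v0.8 section 2, row G180, U-level L?; captain R-6/R-7 2026-08-27: carrier token swap `PlanarSkeletonFrmFrom ↦ PlanarSkeletonFrmQuasi`)
# of the tree module «Transplant/SkelFrmFromBChoiceRootReadY» (sha256 794770655baae52b…) onto the quasi-step carrier `PlanarSkeletonFrmQuasi` (p507026): «SkelFrmQuasiBChoiceRootReadY»

ORIGINAL TITLE: N2 (frames-only node `SamePDropOfSkeletonFrm₁`, OPEN), (R) column, reading rows: **THE SECOND-AXIS ROOT READINGS FROM BOX ROWS** —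

builds on p205010 (kernel theorem, internal audit signed; external expert review pending) — nothing in this file uses p205010; NOTHING is claimed about any open node
((N3-b), the end state).  Lane `prim-bschramm`, seat `prim-hp-8` (gen 62; GEN-Q pen, family BChoiceRoot*/1Root*/BParamsKit·Bridge; tool = captain gen-1 g4's port_genq.py R-14 + p3-g30 T1/T2 + stmt-g33 --force-keep).  Helper file (`--supports stmt-CriticalPhenomena-4575 --as helper`).
PORT RULES (U-wave r1–r4 re-used, GEN-Q hunk classes of p3-g29 #6136): declaration order, names and proof texts are those of «SkelFrmFromBChoiceRootReadY», byte-identical except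
(i) the carrier token `PlanarSkeletonFrmFrom ↦ PlanarSkeletonFrmQuasi` in binders, `namespace`/`end` lines and qualified names (module names `SkelFrmFrom… ↦ SkelFrmQuasi…`
in imports of already-ported rows); (ii) `Φ.step ↦ Φ.qstep` with the called Steps lemma replaced by its `…Q`/`_q` twin and the cost `Φ.M` threaded (none in this file unless
listed below); (iii) `Φ.cyl_connected ↦ Φ.cyl_reach` readers (none unless listed); (iv) graph-ball radii / window floors ×`Φ.M` (none unless listed).  HAND HUNK (L-KitS-1 / L-FLOORMAP-1 ⑧): the kit's R′ is read at the window cost of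
record — `KS0.R'0 κ Φ t p D mk ↦ KS0.R'0N κ Φ (KS.NQ Φ) t p D mk` (stmt-g33's G017 «SkelFrmQuasiBChoiceNums», hp-8's «SkelFrmQuasiBParamsKitSN»).  Carrier-free
residents stay imported/exported from the original «SkelFrmBChoiceRootReadY» exactly as in the FrmFrom port.  Docstrings and citations are the original's.

-/

noncomputable section

open scoped Classical

namespace Summit.CriticalPhenomena.PercolationContinuityZ3.Theorems.Transplant

open MeasureTheory Literature.Probability.Percolation Literature.Probability.LatticeModels SimpleGraph KNCells KNLevels ChainPlanar ChainPara
open Literature.Probability.Percolation.KozmaNitzan.Cells (oth sgOf)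
open Literature.Barriers.CriticalPhenomena (graphBall)
open SkelConc (Consts)
open Skelφ (rootFrame RootFootT TargetFootT shearUnit kgSL kgZ₀ kgZ₁ kgM₁ kgM₂ kgWm₂ kgWp₂ kgA₁ kgFar kgZY₀ kgZY₁ kgM₁Y kgM₂Y kgWm₂Y kgWp₂Y rdLo rdHi KGRows KGYRows)
open TwoAxis.Para (modulus)
open ChainPlanar (ScheduleNP BridgePrm)

namespace PlanarSkeletonFrmQuasi

namespace NegB

open Neg

namespace KS

section ReadY

variable (κ : Consts) {V : Type} [DecidableEq V] [Countable V] {G : SimpleGraph V} [G.LocallyFinite] (Φ : PlanarSkeletonFrmQuasi G) (t : V) (p : unitInterval)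
  (D : Skelφ.StepI.DataNS V) (mk g f qxY WxY : ℕ) (c : Fin 2 → ℕ)

/-! ## §1 The x-prefix's regions (and the bridge region) in one `t`-frame box -/

set_option maxHeartbeats 1600000 in
/-- **Every region of the x-PREFIX (`(qx, Wx) := (0, 0)`, `N := 30`, landing `c₁* = t + (X1(2n_L), Y1s)`), read in the `t`-frame, lies in any box
`[lo, hi]` enclosing `[(−Z₀P, −Z₁P), (31·n_L + Z₀P + 4n_L, Z₁P + 1)]`.** [this work] -/
theorem prefixRegion_mem_box (κ : Consts) {V : Type} [DecidableEq V] [Countable V] {G : SimpleGraph V} [G.LocallyFinite] (Φ : PlanarSkeletonFrmQuasi G) (t : V) (p : unitInterval) (D : Skelφ.StepI.DataNS V) (mk : ℕ) (g : ℕ) (f : ℕ) (hN : EqNumL κ Φ t p D g f) (hg : gFloorKG κ Φ t p D mk ≤ g) (hf : KS.fxR0 κ Φ t p D mk ≤ f)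
    {φ' : V → Site 2} {c₁ : V} (hX : φ' c₁ 0 - φ' t 0 = (X1 κ Φ t p D mk g f (kgq κ Φ t p D g f 0))) (hY : φ' c₁ 1 - φ' t 1 = (Y1s κ Φ t p D mk g f (kgq κ Φ t p D g f 0)))
    {lo hi : Site 2}
    (hlo0 : lo 0 ≤ -kgZ₀ (nL κ Φ t p D g f) (vL κ Φ t p D g f) (kgR κ Φ t p D mk) 0 (kgq κ Φ t p D g f 0) 30 (kgM₁ (nL κ Φ t p D g f) (ℓL κ Φ t p D g f) (hL κ Φ t p D g f) (kgR κ Φ t p D mk) 0 (kgW κ Φ t p D g f 0) 30) (kgM₂ (nL κ Φ t p D g f) (ℓL κ Φ t p D g f) (hL κ Φ t p D g f) (vL κ Φ t p D g f) (kgR κ Φ t p D mk) 0 (kgq κ Φ t p D g f 0) (kgW κ Φ t p D g f 0) 30))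
    (hhi0 : ((((30 : ℕ)) : ℤ) + 1) * (nL κ Φ t p D g f : ℤ) + kgZ₀ (nL κ Φ t p D g f) (vL κ Φ t p D g f) (kgR κ Φ t p D mk) 0 (kgq κ Φ t p D g f 0) 30 (kgM₁ (nL κ Φ t p D g f) (ℓL κ Φ t p D g f) (hL κ Φ t p D g f) (kgR κ Φ t p D mk) 0 (kgW κ Φ t p D g f 0) 30) (kgM₂ (nL κ Φ t p D g f) (ℓL κ Φ t p D g f) (hL κ Φ t p D g f) (vL κ Φ t p D g f) (kgR κ Φ t p D mk) 0 (kgq κ Φ t p D g f 0) (kgW κ Φ t p D g f 0) 30) + 4 * (nL κ Φ t p D g f : ℤ) ≤ hi 0)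
    (hlo1 : lo 1 ≤ -kgZ₁ (nL κ Φ t p D g f) (ℓL κ Φ t p D g f) (hL κ Φ t p D g f) (kgR κ Φ t p D mk) 0 (kgW κ Φ t p D g f 0) 30 (kgM₁ (nL κ Φ t p D g f) (ℓL κ Φ t p D g f) (hL κ Φ t p D g f) (kgR κ Φ t p D mk) 0 (kgW κ Φ t p D g f 0) 30) (kgWm₂ (nL κ Φ t p D g f) (ℓL κ Φ t p D g f) (hL κ Φ t p D g f) (kgR κ Φ t p D mk) 0 (kgW κ Φ t p D g f 0) 30) (kgWp₂ (nL κ Φ t p D g f) (ℓL κ Φ t p D g f) (hL κ Φ t p D g f) (kgR κ Φ t p D mk) 0 (kgW κ Φ t p D g f 0) 30) (kgM₂ (nL κ Φ t p D g f) (ℓL κ Φ t p D g f) (hL κ Φ t p D g f) (vL κ Φ t p D g f) (kgR κ Φ t p D mk) 0 (kgq κ Φ t p D g f 0) (kgW κ Φ t p D g f 0) 30))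
    (hhi1 : kgZ₁ (nL κ Φ t p D g f) (ℓL κ Φ t p D g f) (hL κ Φ t p D g f) (kgR κ Φ t p D mk) 0 (kgW κ Φ t p D g f 0) 30 (kgM₁ (nL κ Φ t p D g f) (ℓL κ Φ t p D g f) (hL κ Φ t p D g f) (kgR κ Φ t p D mk) 0 (kgW κ Φ t p D g f 0) 30) (kgWm₂ (nL κ Φ t p D g f) (ℓL κ Φ t p D g f) (hL κ Φ t p D g f) (kgR κ Φ t p D mk) 0 (kgW κ Φ t p D g f 0) 30) (kgWp₂ (nL κ Φ t p D g f) (ℓL κ Φ t p D g f) (hL κ Φ t p D g f) (kgR κ Φ t p D mk) 0 (kgW κ Φ t p D g f 0) 30) (kgM₂ (nL κ Φ t p D g f) (ℓL κ Φ t p D g f) (hL κ Φ t p D g f) (vL κ Φ t p D g f) (kgR κ Φ t p D mk) 0 (kgq κ Φ t p D g f 0) (kgW κ Φ t p D g f 0) 30) + 1 ≤ hi 1)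
    {k : ℕ} (hk : k ≤ (Skelφ.kgCorrSched ((kgRows0_of κ Φ t p D g f mk 0 0 hN hg).kgVals_ok₁ 30) ((kgRows0_of κ Φ t p D g f mk 0 0 hN hg).kgVals_ok₂ 30) ((kgRows0_of κ Φ t p D g f mk 0 0 hN hg).kgVals_split 30)).N) {w : V} (hw : Skelφ.runX φ' c₁ (nL κ Φ t p D g f) (hL κ Φ t p D g f) 1 w ∈ (Skelφ.kgCorrSched ((kgRows0_of κ Φ t p D g f mk 0 0 hN hg).kgVals_ok₁ 30) ((kgRows0_of κ Φ t p D g f mk 0 0 hN hg).kgVals_ok₂ 30) ((kgRows0_of κ Φ t p D g f mk 0 0 hN hg).kgVals_split 30)).region k) :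
    Skelφ.runX φ' t (nL κ Φ t p D g f) (hL κ Φ t p D g f) 1 w ∈ Finset.Icc lo hi := by
  have H := kgRows0_of κ Φ t p D g f mk 0 0 hN hg
  have hn1 := (one_le_of_eqNumL κ Φ t p D g f hN).1
  have hp := Skelφ.kgCorrSched_region_subset_prism (H.kgVals_ok₁ 30) (H.kgVals_ok₂ 30) (H.kgVals_split 30) hk hw
  obtain ⟨b1, b2, b3, b4⟩ := Skelφ.mem_kgCorrSched_prism_box (H.kgVals_ok₁ 30) (H.kgVals_ok₂ 30) (H.kgVals_split 30) hp
  obtain ⟨hX1lo, hX1hi⟩ := X1_bounds κ Φ t p D mk g f 0 hf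
  have hRs0 : (0 : ℤ) ≤ ((KS.Rs t D mk : ℕ) : ℤ) := by positivity
  have hR0 : (0 : ℤ) ≤ (KS0.R'0N κ Φ (KS.NQ Φ) t p D mk : ℤ) := by positivity
  obtain ⟨hr0, hrn, -⟩ := rows_c₁s_zero κ Φ t p D mk g f (kgq κ Φ t p D g f 0) hN
  have hU : (nL κ Φ t p D g f : ℤ) ≤ (shearUnit (nL κ Φ t p D g f) (hL κ Φ t p D g f) : ℤ) := by
    unfold Skelφ.shearUnit; push_cast; linarith [abs_nonneg (hL κ Φ t p D g f), (Int.natCast_natAbs (hL κ Φ t p D g f)).le]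
  have hbox : Skelφ.runX φ' c₁ (nL κ Φ t p D g f) (hL κ Φ t p D g f) 1 w ∈ Finset.Icc (![-kgZ₀ (nL κ Φ t p D g f) (vL κ Φ t p D g f) (kgR κ Φ t p D mk) 0 (kgq κ Φ t p D g f 0) 30 (kgM₁ (nL κ Φ t p D g f) (ℓL κ Φ t p D g f) (hL κ Φ t p D g f) (kgR κ Φ t p D mk) 0 (kgW κ Φ t p D g f 0) 30) (kgM₂ (nL κ Φ t p D g f) (ℓL κ Φ t p D g f) (hL κ Φ t p D g f) (vL κ Φ t p D g f) (kgR κ Φ t p D mk) 0 (kgq κ Φ t p D g f 0) (kgW κ Φ t p D g f 0) 30), -kgZ₁ (nL κ Φ t p D g f) (ℓL κ Φ t p D g f) (hL κ Φ t p D g f) (kgR κ Φ t p D mk) 0 (kgW κ Φ t p D g f 0) 30 (kgM₁ (nL κ Φ t p D g f) (ℓL κ Φ t p D g f) (hL κ Φ t p D g f) (kgR κ Φ t p D mk) 0 (kgW κ Φ t p D g f 0) 30) (kgWm₂ (nL κ Φ t p D g f) (ℓL κ Φ t p D g f) (hL κ Φ t p D g f) (kgR κ Φ t p D mk) 0 (kgW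 κ Φ t p D g f 0) 30) (kgWp₂ (nL κ Φ t p D g f) (ℓL κ Φ t p D g f) (hL κ Φ t p D g f) (kgR κ Φ t p D mk) 0 (kgW κ Φ t p D g f 0) 30) (kgM₂ (nL κ Φ t p D g f) (ℓL κ Φ t p D g f) (hL κ Φ t p D g f) (vL κ Φ t p D g f) (kgR κ Φ t p D mk) 0 (kgq κ Φ t p D g f 0) (kgW κ Φ t p D g f 0) 30)]) (![((((30 : ℕ)) : ℤ) + 1) * (nL κ Φ t p D g f : ℤ) + kgZ₀ (nL κ Φ t p D g f) (vL κ Φ t p D g f) (kgR κ Φ t p D mk) 0 (kgq κ Φ t p D g f 0) 30 (kgM₁ (nL κ Φ t p D g f) (ℓL κ Φ t p D g f) (hL κ Φ t p D g f) (kgR κ Φ t p D mk) 0 (kgW κ Φ t p D g f 0) 30) (kgM₂ (nL κ Φ t p D g f) (ℓL κ Φ t p D g f) (hL κ Φ t p D g f) (vL κ Φ t p D g f) (kgR κ Φ t p D mk) 0 (kgq κ Φ t p D g f 0) (kgW κ Φ t p D g f 0) 30), kgZ₁ (nL κ Φ t p D g f) (ℓL κ Φ t p D g f) (hL κ Φ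 t p D g f) (kgR κ Φ t p D mk) 0 (kgW κ Φ t p D g f 0) 30 (kgM₁ (nL κ Φ t p D g f) (ℓL κ Φ t p D g f) (hL κ Φ t p D g f) (kgR κ Φ t p D mk) 0 (kgW κ Φ t p D g f 0) 30) (kgWm₂ (nL κ Φ t p D g f) (ℓL κ Φ t p D g f) (hL κ Φ t p D g f) (kgR κ Φ t p D mk) 0 (kgW κ Φ t p D g f 0) 30) (kgWp₂ (nL κ Φ t p D g f) (ℓL κ Φ t p D g f) (hL κ Φ t p D g f) (kgR κ Φ t p D mk) 0 (kgW κ Φ t p D g f 0) 30) (kgM₂ (nL κ Φ t p D g f) (ℓL κ Φ t p D g f) (hL κ Φ t p D g f) (vL κ Φ t p D g f) (kgR κ Φ t p D mk) 0 (kgq κ Φ t p D g f 0) (kgW κ Φ t p D g f 0) 30)]) := by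
    rw [Finset.mem_Icc, Pi.le_def, Pi.le_def, Fin.forall_fin_two, Fin.forall_fin_two]
    simp only [Matrix.cons_val_zero, Matrix.cons_val_one, Matrix.cons_val_fin_one]
    exact ⟨⟨b1, b3⟩, b2, b4⟩
  have hsh := Skelφ.runX_shift_mem_Icc t c₁ (nL κ Φ t p D g f) hn1 (hL κ Φ t p D g f) hX hY hr0 (lt_of_lt_of_le hrn hU) hbox
  rw [Finset.mem_Icc, Pi.le_def, Pi.le_def, Fin.forall_fin_two, Fin.forall_fin_two] at hsh ⊢
  simp only [Pi.add_apply, Matrix.cons_val_zero, Matrix.cons_val_one, Matrix.cons_val_fin_one] at hsh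
  obtain ⟨⟨h0, h1⟩, h2, h3⟩ := hsh
  push_cast at hX1hi h2 hhi0 ⊢
  refine ⟨⟨by linarith, by linarith⟩, by linarith, by linarith⟩

set_option maxHeartbeats 1600000 in
/-- **The bridge region, read in the `t`-run frame, lies in the same prefix box** (`x ∈ n_L ± (R′0 + prB0)`, rows `∈ [−(R′0 + prB0), nℓ/U + R′0 + prB0]`;
`Z₀P ≥ 2n_L`, `Z₁P ≥ R′0 + P + L`, `L ≥ prB0`). [this work] -/
theorem bridgeRegion_mem_pbox (κ : Consts) {V : Type} [DecidableEq V] [Countable V] {G : SimpleGraph V} [G.LocallyFinite] (Φ : PlanarSkeletonFrmQuasi G) (t : V) (p : unitInterval) (D : Skelφ.StepI.DataNS V) (mk : ℕ) (g : ℕ) (f : ℕ) (hN : EqNumL κ Φ t p D g f) (hf : KS.fxR0 κ Φ t p D mk ≤ f) (hfg : 2 * f + 5 * KS0.R'0N κ Φ (KS.NQ Φ) t p D mk + 3 ≤ g)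
    {φ' : V → Site 2} {lo hi : Site 2}
    (hlo0 : lo 0 ≤ -kgZ₀ (nL κ Φ t p D g f) (vL κ Φ t p D g f) (kgR κ Φ t p D mk) 0 (kgq κ Φ t p D g f 0) 30 (kgM₁ (nL κ Φ t p D g f) (ℓL κ Φ t p D g f) (hL κ Φ t p D g f) (kgR κ Φ t p D mk) 0 (kgW κ Φ t p D g f 0) 30) (kgM₂ (nL κ Φ t p D g f) (ℓL κ Φ t p D g f) (hL κ Φ t p D g f) (vL κ Φ t p D g f) (kgR κ Φ t p D mk) 0 (kgq κ Φ t p D g f 0) (kgW κ Φ t p D g f 0) 30))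
    (hhi0 : ((((30 : ℕ)) : ℤ) + 1) * (nL κ Φ t p D g f : ℤ) + kgZ₀ (nL κ Φ t p D g f) (vL κ Φ t p D g f) (kgR κ Φ t p D mk) 0 (kgq κ Φ t p D g f 0) 30 (kgM₁ (nL κ Φ t p D g f) (ℓL κ Φ t p D g f) (hL κ Φ t p D g f) (kgR κ Φ t p D mk) 0 (kgW κ Φ t p D g f 0) 30) (kgM₂ (nL κ Φ t p D g f) (ℓL κ Φ t p D g f) (hL κ Φ t p D g f) (vL κ Φ t p D g f) (kgR κ Φ t p D mk) 0 (kgq κ Φ t p D g f 0) (kgW κ Φ t p D g f 0) 30) + 4 * (nL κ Φ t p D g f : ℤ) ≤ hi 0)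
    (hlo1 : lo 1 ≤ -kgZ₁ (nL κ Φ t p D g f) (ℓL κ Φ t p D g f) (hL κ Φ t p D g f) (kgR κ Φ t p D mk) 0 (kgW κ Φ t p D g f 0) 30 (kgM₁ (nL κ Φ t p D g f) (ℓL κ Φ t p D g f) (hL κ Φ t p D g f) (kgR κ Φ t p D mk) 0 (kgW κ Φ t p D g f 0) 30) (kgWm₂ (nL κ Φ t p D g f) (ℓL κ Φ t p D g f) (hL κ Φ t p D g f) (kgR κ Φ t p D mk) 0 (kgW κ Φ t p D g f 0) 30) (kgWp₂ (nL κ Φ t p D g f) (ℓL κ Φ t p D g f) (hL κ Φ t p D g f) (kgR κ Φ t p D mk) 0 (kgW κ Φ t p D g f 0) 30) (kgM₂ (nL κ Φ t p D g f) (ℓL κ Φ t p D g f) (hL κ Φ t p D g f) (vL κ Φ t p D g f) (kgR κ Φ t p D mk) 0 (kgq κ Φ t p D g f 0) (kgW κ Φ t p D g f 0) 30))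
    (hhi1 : kgZ₁ (nL κ Φ t p D g f) (ℓL κ Φ t p D g f) (hL κ Φ t p D g f) (kgR κ Φ t p D mk) 0 (kgW κ Φ t p D g f 0) 30 (kgM₁ (nL κ Φ t p D g f) (ℓL κ Φ t p D g f) (hL κ Φ t p D g f) (kgR κ Φ t p D mk) 0 (kgW κ Φ t p D g f 0) 30) (kgWm₂ (nL κ Φ t p D g f) (ℓL κ Φ t p D g f) (hL κ Φ t p D g f) (kgR κ Φ t p D mk) 0 (kgW κ Φ t p D g f 0) 30) (kgWp₂ (nL κ Φ t p D g f) (ℓL κ Φ t p D g f) (hL κ Φ t p D g f) (kgR κ Φ t p D mk) 0 (kgW κ Φ t p D g f 0) 30) (kgM₂ (nL κ Φ t p D g f) (ℓL κ Φ t p D g f) (hL κ Φ t p D g f) (vL κ Φ t p D g f) (kgR κ Φ t p D mk) 0 (kgq κ Φ t p D g f 0) (kgW κ Φ t p D g f 0) 30) + 1 ≤ hi 1)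
    {w : V} (hw : rootFrame φ' t 1 w ∈ Finset.Icc (B0 κ Φ t p D mk g f).regionLo (B0 κ Φ t p D mk g f).regionHi) :
    Skelφ.runX φ' t (nL κ Φ t p D g f) (hL κ Φ t p D g f) 1 w ∈ Finset.Icc lo hi := by
  have hn1 := (one_le_of_eqNumL κ Φ t p D g f hN).1
  have hn0 : (0 : ℤ) < (nL κ Φ t p D g f : ℤ) := by exact_mod_cast hn1
  -- the prefix box contains the ReadX box `[(−Z₀P, −(Z₁P + sL)… )]`?  No: we redo the corner comparison directly.
  obtain ⟨e0, e1, e2, e3, e4, -, -, -, -, e9⟩ := B0_apply κ Φ t p D mk g f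
  rw [Finset.mem_Icc, Pi.le_def, Pi.le_def, Fin.forall_fin_two, Fin.forall_fin_two] at hw
  simp only [BridgePrm.regionLo, BridgePrm.regionHi, Pi.sub_apply, Pi.add_apply, Pi.natCast_apply, e0, e1, e2, e3, e4, e9] at hw
  obtain ⟨⟨hx0, hy0⟩, hx1, hy1⟩ := hw
  have hrf0 : rootFrame φ' t 1 w 0 = φ' w 0 - φ' t 0 := by
    show (if (0 : Fin 2) = 0 then (1 : ℤ) * (φ' w 0 - φ' t 0) else φ' w 1 - φ' t 1) = _; rw [if_pos rfl, one_mul]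
  have hrf1 : rootFrame φ' t 1 w 1 = φ' w 1 - φ' t 1 := by
    show (if (1 : Fin 2) = 0 then (1 : ℤ) * (φ' w 0 - φ' t 0) else φ' w 1 - φ' t 1) = _; rw [if_neg (by decide)]
  rw [hrf0] at hx0 hx1
  rw [hrf1] at hy0 hy1
  have hpr : ((prB0 κ Φ t p D mk : ℕ) : ℤ) + (KS0.R'0N κ Φ (KS.NQ Φ) t p D mk : ℤ) + 1 ≤ (f : ℤ) := by
    have h := hf; rw [fxR0_eq] at h; zify at h; linarith [(by positivity : (0 : ℤ) ≤ ((KS.Rs t D mk : ℕ) : ℤ))]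
  have hgf : 2 * (f : ℤ) + 5 * (KS0.R'0N κ Φ (KS.NQ Φ) t p D mk : ℤ) + 3 ≤ (g : ℤ) := by exact_mod_cast hfg
  have hML : (g : ℤ) ≤ ((ML κ Φ t p D g : ℕ) : ℤ) := by exact_mod_cast (ML_le_ML κ Φ t p D g).2
  have hMLn : ((ML κ Φ t p D g : ℕ) : ℤ) < (nL κ Φ t p D g f : ℤ) := by exact_mod_cast (ML_lt_nL κ Φ t p D g f).1
  have hsL := ML_sub_one_le_kgSL κ Φ t p D g f hN
  have hpr0 : (0 : ℤ) ≤ ((prB0 κ Φ t p D mk : ℕ) : ℤ) := by positivity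
  have hR0 : (0 : ℤ) ≤ (KS0.R'0N κ Φ (KS.NQ Φ) t p D mk : ℤ) := by positivity
  have hU0 : (0 : ℤ) < (shearUnit (nL κ Φ t p D g f) (hL κ Φ t p D g f) : ℤ) := Skelφ.shearUnit_pos hn1 _
  -- `Z₀P ≥ 2n`, `Z₁P ≥ R' + (nℓ/U + 1) + L`, `L ≥ 3(nℓ/U) ≥ nℓ/U ≥ sL`
  have hZ₀ : 2 * (nL κ Φ t p D g f : ℤ) ≤ kgZ₀ (nL κ Φ t p D g f) (vL κ Φ t p D g f) (kgR κ Φ t p D mk) 0 (kgq κ Φ t p D g f 0) 30 (kgM₁ (nL κ Φ t p D g f) (ℓL κ Φ t p D g f) (hL κ Φ t p D g f) (kgR κ Φ t p D mk) 0 (kgW κ Φ t p D g f 0) 30) (kgM₂ (nL κ Φ t p D g f) (ℓL κ Φ t p D g f) (hL κ Φ t p D g f) (vL κ Φ t p D g f) (kgR κ Φ t p D mk) 0 (kgq κ Φ t p D g f 0) (kgW κ Φ t p D g f 0) 30) := by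
    unfold Skelφ.kgZ₀
    have : (0 : ℤ) ≤ (((kgR κ Φ t p D mk) : ℕ) : ℤ) := by positivity
    have hv := abs_nonneg (vL κ Φ t p D g f)
    nlinarith
  have hL3 : (nL κ Φ t p D g f : ℤ) * (ℓL κ Φ t p D g f : ℤ) / (shearUnit (nL κ Φ t p D g f) (hL κ Φ t p D g f) : ℤ) ≤ 3 * ((nL κ Φ t p D g f : ℤ) * (ℓL κ Φ t p D g f : ℤ)) / (shearUnit (nL κ Φ t p D g f) (hL κ Φ t p D g f) : ℤ) :=
    Int.ediv_le_ediv hU0 (by linarith [(by positivity : (0 : ℤ) ≤ (nL κ Φ t p D g f : ℤ) * (ℓL κ Φ t p D g f : ℤ))])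
  have hsLP : kgSL (nL κ Φ t p D g f) (ℓL κ Φ t p D g f) (hL κ Φ t p D g f) ≤ (nL κ Φ t p D g f : ℤ) * (ℓL κ Φ t p D g f : ℤ) / (shearUnit (nL κ Φ t p D g f) (hL κ Φ t p D g f) : ℤ) := by
    unfold Skelφ.kgSL
    exact Int.ediv_le_ediv hU0 (by linarith)
  have hZ₁ : (((kgR κ Φ t p D mk) : ℕ) : ℤ) + ((nL κ Φ t p D g f : ℤ) * (ℓL κ Φ t p D g f : ℤ) / (shearUnit (nL κ Φ t p D g f) (hL κ Φ t p D g f) : ℤ) + 1) + (3 * ((nL κ Φ t p D g f : ℤ) * (ℓL κ Φ t p D g f : ℤ)) / (shearUnit (nL κ Φ t p D g f) (hL κ Φ t p D g f) : ℤ) + 1) ≤ kgZ₁ (nL κ Φ t p D g f) (ℓL κ Φ t p D g f) (hL κ Φ t p D g f) (kgR κ Φ t p D mk) 0 (kgW κ Φ t p D g f 0) 30 (kgM₁ (nL κ Φ t p D g f) (ℓL κ Φ t p D g f) (hL κ Φ t p D g f) (kgR κ Φ t p D mk) 0 (kgW κ Φ t p D g f 0) 30) (kgWm₂ (nL κ Φ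 t p D g f) (ℓL κ Φ t p D g f) (hL κ Φ t p D g f) (kgR κ Φ t p D mk) 0 (kgW κ Φ t p D g f 0) 30) (kgWp₂ (nL κ Φ t p D g f) (ℓL κ Φ t p D g f) (hL κ Φ t p D g f) (kgR κ Φ t p D mk) 0 (kgW κ Φ t p D g f 0) 30) (kgM₂ (nL κ Φ t p D g f) (ℓL κ Φ t p D g f) (hL κ Φ t p D g f) (vL κ Φ t p D g f) (kgR κ Φ t p D mk) 0 (kgq κ Φ t p D g f 0) (kgW κ Φ t p D g f 0) 30) := by
    unfold Skelφ.kgZ₁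
    push_cast
    have h1 : (0 : ℤ) ≤ ((Skelφ.kgA₁ (nL κ Φ t p D g f) (ℓL κ Φ t p D g f) (hL κ Φ t p D g f) (kgR κ Φ t p D mk) (kgW κ Φ t p D g f 0) 30 : ℕ) : ℤ) := by positivity
    have h4 : (0 : ℤ) ≤ ((kgWm₂ (nL κ Φ t p D g f) (ℓL κ Φ t p D g f) (hL κ Φ t p D g f) (kgR κ Φ t p D mk) 0 (kgW κ Φ t p D g f 0) 30 : ℕ) : ℤ) := by positivity
    have h5 : (0 : ℤ) ≤ ((kgWp₂ (nL κ Φ t p D g f) (ℓL κ Φ t p D g f) (hL κ Φ t p D g f) (kgR κ Φ t p D mk) 0 (kgW κ Φ t p D g f 0) 30 : ℕ) : ℤ) := by positivity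
    have h6 : (0 : ℤ) ≤ (((kgM₁ (nL κ Φ t p D g f) (ℓL κ Φ t p D g f) (hL κ Φ t p D g f) (kgR κ Φ t p D mk) 0 (kgW κ Φ t p D g f 0) 30 : ℕ) : ℤ) + (kgM₂ (nL κ Φ t p D g f) (ℓL κ Φ t p D g f) (hL κ Φ t p D g f) (vL κ Φ t p D g f) (kgR κ Φ t p D mk) 0 (kgq κ Φ t p D g f 0) (kgW κ Φ t p D g f 0) 30 : ℕ) + 2) * ((((kgR κ Φ t p D mk) : ℕ) : ℤ) + 0) := by positivity
    linarith
  have hkgR : (((kgR κ Φ t p D mk) : ℕ) : ℤ) = (KS0.R'0N κ Φ (KS.NQ Φ) t p D mk : ℤ) := rfl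
  -- run coordinates of `w`
  have hUeq : (shearUnit (nL κ Φ t p D g f) (hL κ Φ t p D g f) : ℤ) = (nL κ Φ t p D g f : ℤ) + |hL κ Φ t p D g f| := by
    unfold Skelφ.shearUnit; push_cast [Int.natCast_natAbs]; rfl
  have habs := abs_nonneg (hL κ Φ t p D g f)
  have hdx : |φ' w 0 - φ' t 0 - (nL κ Φ t p D g f : ℤ)| ≤ (KS0.R'0N κ Φ (KS.NQ Φ) t p D mk : ℤ) + (prB0 κ Φ t p D mk : ℕ) := by
    rw [abs_le]; constructor <;> linarith
  have hp1 : |hL κ Φ t p D g f * (φ' w 0 - φ' t 0 - (nL κ Φ t p D g f : ℤ))| ≤ |hL κ Φ t p D g f| * ((KS0.R'0N κ Φ (KS.NQ Φ) t p D mk : ℤ) + (prB0 κ Φ t p D mk : ℕ)) := by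
    rw [abs_mul]; exact mul_le_mul_of_nonneg_left hdx habs
  obtain ⟨hp1a, hp1b⟩ := abs_le.1 hp1
  have eS : (nL κ Φ t p D g f : ℤ) * (φ' w 1 - φ' t 1) - hL κ Φ t p D g f * (φ' w 0 - φ' t 0) =
      (nL κ Φ t p D g f : ℤ) * (φ' w 1 - φ' t 1 - hL κ Φ t p D g f) - hL κ Φ t p D g f * (φ' w 0 - φ' t 0 - (nL κ Φ t p D g f : ℤ)) := by ring
  have hslo : -((shearUnit (nL κ Φ t p D g f) (hL κ Φ t p D g f) : ℤ) * ((KS0.R'0N κ Φ (KS.NQ Φ) t p D mk : ℤ) + (prB0 κ Φ t p D mk : ℕ))) ≤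
      (nL κ Φ t p D g f : ℤ) * (φ' w 1 - φ' t 1) - hL κ Φ t p D g f * (φ' w 0 - φ' t 0) := by
    rw [eS, hUeq]
    have : (nL κ Φ t p D g f : ℤ) * (-((KS0.R'0N κ Φ (KS.NQ Φ) t p D mk : ℤ) + (prB0 κ Φ t p D mk : ℕ))) ≤ (nL κ Φ t p D g f : ℤ) * (φ' w 1 - φ' t 1 - hL κ Φ t p D g f) :=
      mul_le_mul_of_nonneg_left (by linarith) hn0.le
    nlinarith
  have hshi : (nL κ Φ t p D g f : ℤ) * (φ' w 1 - φ' t 1) - hL κ Φ t p D g f * (φ' w 0 - φ' t 0) ≤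
      (nL κ Φ t p D g f : ℤ) * (ℓL κ Φ t p D g f) + (shearUnit (nL κ Φ t p D g f) (hL κ Φ t p D g f) : ℤ) * ((KS0.R'0N κ Φ (KS.NQ Φ) t p D mk : ℤ) + (prB0 κ Φ t p D mk : ℕ)) := by
    rw [eS, hUeq]
    have : (nL κ Φ t p D g f : ℤ) * (φ' w 1 - φ' t 1 - hL κ Φ t p D g f) ≤ (nL κ Φ t p D g f : ℤ) * ((ℓL κ Φ t p D g f : ℤ) + ((KS0.R'0N κ Φ (KS.NQ Φ) t p D mk : ℤ) + (prB0 κ Φ t p D mk : ℕ))) :=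
      mul_le_mul_of_nonneg_left (by linarith) hn0.le
    nlinarith
  have hrlo : -((KS0.R'0N κ Φ (KS.NQ Φ) t p D mk : ℤ) + (prB0 κ Φ t p D mk : ℕ)) ≤
      ((nL κ Φ t p D g f : ℤ) * (φ' w 1 - φ' t 1) - hL κ Φ t p D g f * (φ' w 0 - φ' t 0)) / (shearUnit (nL κ Φ t p D g f) (hL κ Φ t p D g f) : ℤ) := by
    have h := Int.ediv_le_ediv hU0 hslo
    have e : -((shearUnit (nL κ Φ t p D g f) (hL κ Φ t p D g f) : ℤ) * ((KS0.R'0N κ Φ (KS.NQ Φ) t p D mk : ℤ) + (prB0 κ Φ t p D mk : ℕ))) =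
        (-((KS0.R'0N κ Φ (KS.NQ Φ) t p D mk : ℤ) + (prB0 κ Φ t p D mk : ℕ))) * (shearUnit (nL κ Φ t p D g f) (hL κ Φ t p D g f) : ℤ) := by ring
    rw [e, Int.mul_ediv_cancel _ (ne_of_gt hU0)] at h
    exact h
  have hrhi : ((nL κ Φ t p D g f : ℤ) * (φ' w 1 - φ' t 1) - hL κ Φ t p D g f * (φ' w 0 - φ' t 0)) / (shearUnit (nL κ Φ t p D g f) (hL κ Φ t p D g f) : ℤ) ≤
      (nL κ Φ t p D g f : ℤ) * (ℓL κ Φ t p D g f : ℤ) / (shearUnit (nL κ Φ t p D g f) (hL κ Φ t p D g f) : ℤ) + ((KS0.R'0N κ Φ (KS.NQ Φ) t p D mk : ℤ) + (prB0 κ Φ t p D mk : ℕ)) := by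
    have h := Int.ediv_le_ediv hU0 hshi
    rw [Int.add_mul_ediv_left _ _ (ne_of_gt hU0)] at h
    exact h
  have hP0 : (0 : ℤ) ≤ (nL κ Φ t p D g f : ℤ) * (ℓL κ Φ t p D g f : ℤ) / (shearUnit (nL κ Φ t p D g f) (hL κ Φ t p D g f) : ℤ) := Int.ediv_nonneg (by positivity) hU0.le
  have hkR0 : (0 : ℤ) ≤ (((kgR κ Φ t p D mk) : ℕ) : ℤ) := by positivity
  rw [Finset.mem_Icc, Pi.le_def, Pi.le_def, Fin.forall_fin_two, Fin.forall_fin_two]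
  simp only [Skelφ.runX_zero, Skelφ.runX_one, Skelφ.shearCoord_apply, Skelφ.relCoord_apply, one_mul]
  push_cast at hhi0 ⊢
  refine ⟨⟨by linarith, by linarith⟩, by nlinarith, by linarith⟩

/-! ## §2 The root y′-corridor's regions and last core in `t`-frame boxes -/

set_option maxHeartbeats 1600000 in
-- GEN-Q (R-2, captain 2026-08-27): `PlanarSkeletonFrmFrom.NegB.KS.yRegion_mem_box` is not in the used cone of the node top — not ported.

/-- **The root y′-corridor's LAST CORE, read in the `t`-frame, lies in any box `[lo, hi]` enclosing the (C) arrival box (`kgLastLoY/HiY` at the FULL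
window) widened by `(2n_L, sL)` below and `(n_L, 1)` above** (`rootBoxY_across_R`, `rootBoxY_bottom_R`, `rootBoxY_top_R` + the row shift). [this work] -/
theorem yLast_mem_box (κ : Consts) {V : Type} [DecidableEq V] [Countable V] {G : SimpleGraph V} [G.LocallyFinite] (Φ : PlanarSkeletonFrmQuasi G) (t : V) (p : unitInterval) (D : Skelφ.StepI.DataNS V) (mk : ℕ) (g : ℕ) (f : ℕ) (qxY : ℕ) (WxY : ℕ) (hN : EqNumL κ Φ t p D g f) (hg : gFloorKG κ Φ t p D mk ≤ g) (hg2 : 40 * Neg.K κ * KS0.R'0N κ Φ (KS.NQ Φ) t p D mk ≤ g)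
    (hf : KS.fxR0 κ Φ t p D mk ≤ f) (hWxY : KS.Rs t D mk + 34 * nL κ Φ t p D g f + 29 * KS0.R'0N κ Φ (KS.NQ Φ) t p D mk + 2 ≤ WxY) (hWx : WxY ≤ 100 * nL κ Φ t p D g f)
    {φ' : V → Site 2} {c₂ : V} (hX : φ' c₂ 0 - φ' t 0 = (((KS.X2R κ Φ t p D mk g f WxY) : ℕ) : ℤ)) (hY : φ' c₂ 1 - φ' t 1 = (KS.Y2R κ Φ t p D mk g f WxY))
    {lo hi : Site 2}
    (hlo0 : lo 0 ≤ ((kgYRows0_of κ Φ t p D g f mk qxY WxY hN hg).kgLastLoY (kgNYv0 κ Φ t p D g f mk qxY WxY)) 0 - 2 * (nL κ Φ t p D g f : ℤ))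
    (hhi0 : ((kgYRows0_of κ Φ t p D g f mk qxY WxY hN hg).kgLastHiY (kgNYv0 κ Φ t p D g f mk qxY WxY)) 0 + (nL κ Φ t p D g f : ℤ) ≤ hi 0)
    (hlo1 : lo 1 ≤ ((kgYRows0_of κ Φ t p D g f mk qxY WxY hN hg).kgLastLoY (kgNYv0 κ Φ t p D g f mk qxY WxY)) 1 - (kgSL (nL κ Φ t p D g f) (ℓL κ Φ t p D g f) (hL κ Φ t p D g f)))
    (hhi1 : ((kgYRows0_of κ Φ t p D g f mk qxY WxY hN hg).kgLastHiY (kgNYv0 κ Φ t p D g f mk qxY WxY)) 1 + 1 ≤ hi 1)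
    {w : V} (hw : Skelφ.runX φ' c₂ (nL κ Φ t p D g f) (hL κ Φ t p D g f) 1 w ∈ ScheduleNP.core (Skelφ.kgCorrSchedY (kgYRows0_of κ Φ t p D g f mk qxY (KS.WxYR κ Φ t p D mk g f WxY) hN hg).hn (kgYRows0_of κ Φ t p D g f mk qxY (KS.WxYR κ Φ t p D mk g f WxY) hN hg).hv (kgYRows0_of κ Φ t p D g f mk qxY (KS.WxYR κ Φ t p D mk g f WxY) hN hg).hlay ((kgYRows0_of κ Φ t p D g f mk qxY (KS.WxYR κ Φ t p D mk g f WxY) hN hg).kgYVals_ok₁ (kgNYv0 κ Φ t p D g f mk qxY WxY)) ((kgYRows0_of κ Φ t p D g f mk qxY (KS.WxYR κ Φ t p D mk g f WxY) hN hg).kgYVals_ok₂ (kgNYv0 κ Φ t p D g f mk qxY WxY)) ((kgYRows0_of κ Φ t p D g f mk qxY (KS.WxYR κ Φ t p D mk g f WxY) hN hg).kgYVals_split (kgNYv0 κ Φ t p D g f mk qxY WxY))) ((Skelφ.kgCorrSchedY (kgYRows0_of κ Φ t p D g f mk qxY (KS.WxYR κ Φ t p D mk g f WxY) hN hg).hn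 (kgYRows0_of κ Φ t p D g f mk qxY (KS.WxYR κ Φ t p D mk g f WxY) hN hg).hv (kgYRows0_of κ Φ t p D g f mk qxY (KS.WxYR κ Φ t p D mk g f WxY) hN hg).hlay ((kgYRows0_of κ Φ t p D g f mk qxY (KS.WxYR κ Φ t p D mk g f WxY) hN hg).kgYVals_ok₁ (kgNYv0 κ Φ t p D g f mk qxY WxY)) ((kgYRows0_of κ Φ t p D g f mk qxY (KS.WxYR κ Φ t p D mk g f WxY) hN hg).kgYVals_ok₂ (kgNYv0 κ Φ t p D g f mk qxY WxY)) ((kgYRows0_of κ Φ t p D g f mk qxY (KS.WxYR κ Φ t p D mk g f WxY) hN hg).kgYVals_split (kgNYv0 κ Φ t p D g f mk qxY WxY))).N + 1)) :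
    Skelφ.runX φ' t (nL κ Φ t p D g f) (hL κ Φ t p D g f) 1 w ∈ Finset.Icc lo hi := by
  have H := kgYRows0_of κ Φ t p D g f mk qxY (KS.WxYR κ Φ t p D mk g f WxY) hN hg
  have hn1 := (one_le_of_eqNumL κ Φ t p D g f hN).1
  have hlast := H.mem_Icc_of_mem_lastY (kgNYv0 κ Φ t p D g f mk qxY WxY) hw
  obtain ⟨a0, a1⟩ := rootBoxY_across_R κ Φ t p D mk g f qxY WxY hN hg hg2 hWxY hWx
  have a2 := rootBoxY_top_R κ Φ t p D mk g f qxY WxY hN hg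
  have a3 := rootBoxY_bottom_R κ Φ t p D mk g f qxY WxY hN hg hg2 hf hWxY hWx
  obtain ⟨hr0, hrn, -⟩ := rows_c₂_zero κ Φ t p D mk g f WxY hN
  have hU : (nL κ Φ t p D g f : ℤ) ≤ (shearUnit (nL κ Φ t p D g f) (hL κ Φ t p D g f) : ℤ) := by
    unfold Skelφ.shearUnit; push_cast; linarith [abs_nonneg (hL κ Φ t p D g f), (Int.natCast_natAbs (hL κ Φ t p D g f)).le]
  have hsh := Skelφ.runX_shift_mem_Icc t c₂ (nL κ Φ t p D g f) hn1 (hL κ Φ t p D g f) hX hY hr0 (lt_of_lt_of_le hrn hU) hlast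
  rw [Finset.mem_Icc, Pi.le_def, Pi.le_def, Fin.forall_fin_two, Fin.forall_fin_two] at hsh ⊢
  simp only [Pi.add_apply, Matrix.cons_val_zero, Matrix.cons_val_one, Matrix.cons_val_fin_one] at hsh
  obtain ⟨⟨h0, h1⟩, h2, h3⟩ := hsh
  refine ⟨⟨by linarith, by linarith⟩, by linarith, by linarith⟩

/-! ## §3 The footprint arithmetic at `du = (1, true)` -/

export PlanarSkeletonFrm.NegB.KS (rootFootT_snd_of_bounds)

export PlanarSkeletonFrm.NegB.KS (targetFootT_snd_of_bounds)

/-! ## §4 The four rows of the second-axis skeleton from three box-reading rows -/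

/-- `1 ≤ r₀` at the tuple (`40·kq ≤ r_i`, `1 ≤ kq`). [folklore] -/
theorem one_le_r_fst (κ : Consts) {V : Type} [DecidableEq V] [Countable V] {G : SimpleGraph V} [G.LocallyFinite] (Φ : PlanarSkeletonFrmQuasi G) (t : V) (p : unitInterval) (D : Skelφ.StepI.DataNS V) (g : ℕ) (f : ℕ) (c : Fin 2 → ℕ) (hN : EqNumL κ Φ t p D g f) : 1 ≤ (fcellsT κ Φ t p D g f c).r 0 := by
  obtain ⟨-, -, -, -, -, -, -, -, hkq, hr40⟩ := hsc_Q κ Φ t p D g f hN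
  have h := hr40 0; rw [fcellsT_r]; have hk : (1 : ℤ) ≤ ((Neg.Kq κ : ℕ) : ℤ) := by exact_mod_cast hkq
  have : (1 : ℤ) ≤ (((fcellsA κ Φ t p D g f).r 0 : ℕ) : ℤ) := by linarith
  exact_mod_cast this

set_option maxHeartbeats 1600000 in
/-- **`hfoot₂` OF THE SECOND-AXIS (R) SKELETON** (x-prefix regions) FROM ONE BOX-READING ROW. [cite: KozmaNitzan2024, §4 p. 28 ((32) at the root)] -/
theorem hfoot₂_RY (κ : Consts) {V : Type} [DecidableEq V] [Countable V] {G : SimpleGraph V} [G.LocallyFinite] (Φ : PlanarSkeletonFrmQuasi G) (t : V) (p : unitInterval) (D : Skelφ.StepI.DataNS V) (mk : ℕ) (g : ℕ) (f : ℕ) (c : Fin 2 → ℕ) (hN : EqNumL κ Φ t p D g f) (hg : gFloorKG κ Φ t p D mk ≤ g) (hf : KS.fxR0 κ Φ t p D mk ≤ f)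
    {lo hi : Site 2}
    (hlo0 : lo 0 ≤ -kgZ₀ (nL κ Φ t p D g f) (vL κ Φ t p D g f) (kgR κ Φ t p D mk) 0 (kgq κ Φ t p D g f 0) 30 (kgM₁ (nL κ Φ t p D g f) (ℓL κ Φ t p D g f) (hL κ Φ t p D g f) (kgR κ Φ t p D mk) 0 (kgW κ Φ t p D g f 0) 30) (kgM₂ (nL κ Φ t p D g f) (ℓL κ Φ t p D g f) (hL κ Φ t p D g f) (vL κ Φ t p D g f) (kgR κ Φ t p D mk) 0 (kgq κ Φ t p D g f 0) (kgW κ Φ t p D g f 0) 30))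
    (hhi0 : ((((30 : ℕ)) : ℤ) + 1) * (nL κ Φ t p D g f : ℤ) + kgZ₀ (nL κ Φ t p D g f) (vL κ Φ t p D g f) (kgR κ Φ t p D mk) 0 (kgq κ Φ t p D g f 0) 30 (kgM₁ (nL κ Φ t p D g f) (ℓL κ Φ t p D g f) (hL κ Φ t p D g f) (kgR κ Φ t p D mk) 0 (kgW κ Φ t p D g f 0) 30) (kgM₂ (nL κ Φ t p D g f) (ℓL κ Φ t p D g f) (hL κ Φ t p D g f) (vL κ Φ t p D g f) (kgR κ Φ t p D mk) 0 (kgq κ Φ t p D g f 0) (kgW κ Φ t p D g f 0) 30) + 4 * (nL κ Φ t p D g f : ℤ) ≤ hi 0)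
    (hlo1 : lo 1 ≤ -kgZ₁ (nL κ Φ t p D g f) (ℓL κ Φ t p D g f) (hL κ Φ t p D g f) (kgR κ Φ t p D mk) 0 (kgW κ Φ t p D g f 0) 30 (kgM₁ (nL κ Φ t p D g f) (ℓL κ Φ t p D g f) (hL κ Φ t p D g f) (kgR κ Φ t p D mk) 0 (kgW κ Φ t p D g f 0) 30) (kgWm₂ (nL κ Φ t p D g f) (ℓL κ Φ t p D g f) (hL κ Φ t p D g f) (kgR κ Φ t p D mk) 0 (kgW κ Φ t p D g f 0) 30) (kgWp₂ (nL κ Φ t p D g f) (ℓL κ Φ t p D g f) (hL κ Φ t p D g f) (kgR κ Φ t p D mk) 0 (kgW κ Φ t p D g f 0) 30) (kgM₂ (nL κ Φ t p D g f) (ℓL κ Φ t p D g f) (hL κ Φ t p D g f) (vL κ Φ t p D g f) (kgR κ Φ t p D mk) 0 (kgq κ Φ t p D g f 0) (kgW κ Φ t p D g f 0) 30))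
    (hhi1 : kgZ₁ (nL κ Φ t p D g f) (ℓL κ Φ t p D g f) (hL κ Φ t p D g f) (kgR κ Φ t p D mk) 0 (kgW κ Φ t p D g f 0) 30 (kgM₁ (nL κ Φ t p D g f) (ℓL κ Φ t p D g f) (hL κ Φ t p D g f) (kgR κ Φ t p D mk) 0 (kgW κ Φ t p D g f 0) 30) (kgWm₂ (nL κ Φ t p D g f) (ℓL κ Φ t p D g f) (hL κ Φ t p D g f) (kgR κ Φ t p D mk) 0 (kgW κ Φ t p D g f 0) 30) (kgWp₂ (nL κ Φ t p D g f) (ℓL κ Φ t p D g f) (hL κ Φ t p D g f) (kgR κ Φ t p D mk) 0 (kgW κ Φ t p D g f 0) 30) (kgM₂ (nL κ Φ t p D g f) (ℓL κ Φ t p D g f) (hL κ Φ t p D g f) (vL κ Φ t p D g f) (kgR κ Φ t p D mk) 0 (kgq κ Φ t p D g f 0) (kgW κ Φ t p D g f 0) 30) + 1 ≤ hi 1)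
    (hrow : -(3 * (((fcellsA κ Φ t p D g f).r 0 : ℕ) : ℤ)) + 1 ≤ rdLo (Aof κ) (nL κ Φ t p D g f) (hL κ Φ t p D g f) (vL κ Φ t p D g f) (vβL κ Φ t p D g f) (prFA κ Φ t p D g f).c₀ (prFA κ Φ t p D g f).c₁ (prFA κ Φ t p D g f).D lo hi 0 ∧ rdHi (Aof κ) (nL κ Φ t p D g f) (hL κ Φ t p D g f) (vL κ Φ t p D g f) (vβL κ Φ t p D g f) (prFA κ Φ t p D g f).c₀ (prFA κ Φ t p D g f).c₁ (prFA κ Φ t p D g f).D lo hi 0 ≤ 3 * (((fcellsA κ Φ t p D g f).r 0 : ℕ) : ℤ) - 1 ∧ -(5 * (((fcellsA κ Φ t p D g f).r 1 : ℕ) : ℤ)) + 1 ≤ rdLo (Aof κ) (nL κ Φ t p D g f) (hL κ Φ t p D g f) (vL κ Φ t p D g f) (vβL κ Φ t p D g f) (prFA κ Φ t p D g f).c₀ (prFA κ Φ t p D g f).c₁ (prFA κ Φ t p D g f).D lo hi 1 ∧ rdHi (Aof κ) (nL κ Φ t p D g f) (hL κ Φ t p D g f) (vL κ Φ t p D g f)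 (vβL κ Φ t p D g f) (prFA κ Φ t p D g f).c₀ (prFA κ Φ t p D g f).c₁ (prFA κ Φ t p D g f).D lo hi 1 ≤ 25 * (((fcellsA κ Φ t p D g f).r 1 : ℕ) : ℤ) - 1)
    {φ' : V → Site 2} {c₁ : V} (hX : φ' c₁ 0 - φ' t 0 = (X1 κ Φ t p D mk g f (kgq κ Φ t p D g f 0))) (hY : φ' c₁ 1 - φ' t 1 = (Y1s κ Φ t p D mk g f (kgq κ Φ t p D g f 0))) :
    ∀ k ≤ (Skelφ.kgCorrSched ((kgRows0_of κ Φ t p D g f mk 0 0 hN hg).kgVals_ok₁ 30) ((kgRows0_of κ Φ t p D g f mk 0 0 hN hg).kgVals_ok₂ 30) ((kgRows0_of κ Φ t p D g f mk 0 0 hN hg).kgVals_split 30)).N, ∀ w : V, Skelφ.runX φ' c₁ (nL κ Φ t p D g f) (hL κ Φ t p D g f) 1 w ∈ (Skelφ.kgCorrSched ((kgRows0_of κ Φ t p D g f mk 0 0 hN hg).kgVals_ok₁ 30) ((kgRows0_of κ Φ t p D g f mk 0 0 hN hg).kgVals_ok₂ 30) ((kgRows0_of κ Φ t p D g f mk 0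 0 hN hg).kgVals_split 30)).region k →
      RootFootT (fcellsT κ Φ t p D g f c) (((1 : Fin 2), true) : MDir) (fineA κ Φ t p D g f φ' w) := by
  intro k hk w hw
  have hb := prefixRegion_mem_box κ Φ t p D mk g f hN hg hf hX hY hlo0 hhi0 hlo1 hhi1 hk hw
  have h0 := fine_mem_rd_root κ Φ t p D g f hN hb 0
  have h1 := fine_mem_rd_root κ Φ t p D g f hN hb 1
  obtain ⟨hl0, hu0, hl1, hu1⟩ := hrow
  exact rootFootT_snd_of_bounds (fcellsT κ Φ t p D g f c) (by rw [fcellsT_r]; linarith [h1.1]) (by rw [fcellsT_r]; linarith [h1.2])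
    (by rw [fcellsT_r]; linarith [h0.1]) (by rw [fcellsT_r]; linarith [h0.2]) (one_le_r_fst κ Φ t p D g f c hN)

set_option maxHeartbeats 1600000 in
/-- **`hfoot₁` OF THE SECOND-AXIS (R) SKELETON** (bridge region) FROM THE SAME BOX-READING ROW. [cite: KozmaNitzan2024, §4 p. 28] -/
theorem hfoot₁_RY (κ : Consts) {V : Type} [DecidableEq V] [Countable V] {G : SimpleGraph V} [G.LocallyFinite] (Φ : PlanarSkeletonFrmQuasi G) (t : V) (p : unitInterval) (D : Skelφ.StepI.DataNS V) (mk : ℕ) (g : ℕ) (f : ℕ) (c : Fin 2 → ℕ) (hN : EqNumL κ Φ t p D g f) (hf : KS.fxR0 κ Φ t p D mk ≤ f)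
    (hfg : 2 * f + 5 * KS0.R'0N κ Φ (KS.NQ Φ) t p D mk + 3 ≤ g)
    {lo hi : Site 2}
    (hlo0 : lo 0 ≤ -kgZ₀ (nL κ Φ t p D g f) (vL κ Φ t p D g f) (kgR κ Φ t p D mk) 0 (kgq κ Φ t p D g f 0) 30 (kgM₁ (nL κ Φ t p D g f) (ℓL κ Φ t p D g f) (hL κ Φ t p D g f) (kgR κ Φ t p D mk) 0 (kgW κ Φ t p D g f 0) 30) (kgM₂ (nL κ Φ t p D g f) (ℓL κ Φ t p D g f) (hL κ Φ t p D g f) (vL κ Φ t p D g f) (kgR κ Φ t p D mk) 0 (kgq κ Φ t p D g f 0) (kgW κ Φ t p D g f 0) 30))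
    (hhi0 : ((((30 : ℕ)) : ℤ) + 1) * (nL κ Φ t p D g f : ℤ) + kgZ₀ (nL κ Φ t p D g f) (vL κ Φ t p D g f) (kgR κ Φ t p D mk) 0 (kgq κ Φ t p D g f 0) 30 (kgM₁ (nL κ Φ t p D g f) (ℓL κ Φ t p D g f) (hL κ Φ t p D g f) (kgR κ Φ t p D mk) 0 (kgW κ Φ t p D g f 0) 30) (kgM₂ (nL κ Φ t p D g f) (ℓL κ Φ t p D g f) (hL κ Φ t p D g f) (vL κ Φ t p D g f) (kgR κ Φ t p D mk) 0 (kgq κ Φ t p D g f 0) (kgW κ Φ t p D g f 0) 30) + 4 * (nL κ Φ t p D g f : ℤ) ≤ hi 0)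
    (hlo1 : lo 1 ≤ -kgZ₁ (nL κ Φ t p D g f) (ℓL κ Φ t p D g f) (hL κ Φ t p D g f) (kgR κ Φ t p D mk) 0 (kgW κ Φ t p D g f 0) 30 (kgM₁ (nL κ Φ t p D g f) (ℓL κ Φ t p D g f) (hL κ Φ t p D g f) (kgR κ Φ t p D mk) 0 (kgW κ Φ t p D g f 0) 30) (kgWm₂ (nL κ Φ t p D g f) (ℓL κ Φ t p D g f) (hL κ Φ t p D g f) (kgR κ Φ t p D mk) 0 (kgW κ Φ t p D g f 0) 30) (kgWp₂ (nL κ Φ t p D g f) (ℓL κ Φ t p D g f) (hL κ Φ t p D g f) (kgR κ Φ t p D mk) 0 (kgW κ Φ t p D g f 0) 30) (kgM₂ (nL κ Φ t p D g f) (ℓL κ Φ t p D g f) (hL κ Φ t p D g f) (vL κ Φ t p D g f) (kgR κ Φ t p D mk) 0 (kgq κ Φ t p D g f 0) (kgW κ Φ t p D g f 0) 30))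
    (hhi1 : kgZ₁ (nL κ Φ t p D g f) (ℓL κ Φ t p D g f) (hL κ Φ t p D g f) (kgR κ Φ t p D mk) 0 (kgW κ Φ t p D g f 0) 30 (kgM₁ (nL κ Φ t p D g f) (ℓL κ Φ t p D g f) (hL κ Φ t p D g f) (kgR κ Φ t p D mk) 0 (kgW κ Φ t p D g f 0) 30) (kgWm₂ (nL κ Φ t p D g f) (ℓL κ Φ t p D g f) (hL κ Φ t p D g f) (kgR κ Φ t p D mk) 0 (kgW κ Φ t p D g f 0) 30) (kgWp₂ (nL κ Φ t p D g f) (ℓL κ Φ t p D g f) (hL κ Φ t p D g f) (kgR κ Φ t p D mk) 0 (kgW κ Φ t p D g f 0) 30) (kgM₂ (nL κ Φ t p D g f) (ℓL κ Φ t p D g f) (hL κ Φ t p D g f) (vL κ Φ t p D g f) (kgR κ Φ t p D mk) 0 (kgq κ Φ t p D g f 0) (kgW κ Φ t p D g f 0) 30) + 1 ≤ hi 1)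
    (hrow : -(3 * (((fcellsA κ Φ t p D g f).r 0 : ℕ) : ℤ)) + 1 ≤ rdLo (Aof κ) (nL κ Φ t p D g f) (hL κ Φ t p D g f) (vL κ Φ t p D g f) (vβL κ Φ t p D g f) (prFA κ Φ t p D g f).c₀ (prFA κ Φ t p D g f).c₁ (prFA κ Φ t p D g f).D lo hi 0 ∧ rdHi (Aof κ) (nL κ Φ t p D g f) (hL κ Φ t p D g f) (vL κ Φ t p D g f) (vβL κ Φ t p D g f) (prFA κ Φ t p D g f).c₀ (prFA κ Φ t p D g f).c₁ (prFA κ Φ t p D g f).D lo hi 0 ≤ 3 * (((fcellsA κ Φ t p D g f).r 0 : ℕ) : ℤ) - 1 ∧ -(5 * (((fcellsA κ Φ t p D g f).r 1 : ℕ) : ℤ)) + 1 ≤ rdLo (Aof κ) (nL κ Φ t p D g f) (hL κ Φ t p D g f) (vL κ Φ t p D g f) (vβL κ Φ t p D g f) (prFA κ Φ t p D g f).c₀ (prFA κ Φ t p D g f).c₁ (prFA κ Φ t p D g f).D lo hi 1 ∧ rdHi (Aof κ) (nL κ Φ t p D g f) (hL κ Φ t p D g f) (vL κ Φ t p D g f)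 (vβL κ Φ t p D g f) (prFA κ Φ t p D g f).c₀ (prFA κ Φ t p D g f).c₁ (prFA κ Φ t p D g f).D lo hi 1 ≤ 25 * (((fcellsA κ Φ t p D g f).r 1 : ℕ) : ℤ) - 1)
    {φ' : V → Site 2} :
    ∀ w : V, rootFrame φ' t 1 w ∈ Finset.Icc (B0 κ Φ t p D mk g f).regionLo (B0 κ Φ t p D mk g f).regionHi →
      RootFootT (fcellsT κ Φ t p D g f c) (((1 : Fin 2), true) : MDir) (fineA κ Φ t p D g f φ' w) := by
  intro w hw
  have hb := bridgeRegion_mem_pbox κ Φ t p D mk g f hN hf hfg hlo0 hhi0 hlo1 hhi1 hw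
  have h0 := fine_mem_rd_root κ Φ t p D g f hN hb 0
  have h1 := fine_mem_rd_root κ Φ t p D g f hN hb 1
  obtain ⟨hl0, hu0, hl1, hu1⟩ := hrow
  exact rootFootT_snd_of_bounds (fcellsT κ Φ t p D g f c) (by rw [fcellsT_r]; linarith [h1.1]) (by rw [fcellsT_r]; linarith [h1.2])
    (by rw [fcellsT_r]; linarith [h0.1]) (by rw [fcellsT_r]; linarith [h0.2]) (one_le_r_fst κ Φ t p D g f c hN)

set_option maxHeartbeats 1600000 in
-- GEN-Q (R-2, captain 2026-08-27): `PlanarSkeletonFrmFrom.NegB.KS.hfoot₃_R` is not in the used cone of the node top — not ported.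

/-- **`hlastf` OF THE SECOND-AXIS (R) SKELETON** (root y′-corridor's last core → arrival cube `b`, creep value `(fcellsT … c).c 1`) FROM ONE ARRIVAL-BOX
READING ROW. [cite: KozmaNitzan2024, §4 p. 28 ((32) at the root)] -/
theorem hlastf_RY (κ : Consts) {V : Type} [DecidableEq V] [Countable V] {G : SimpleGraph V} [G.LocallyFinite] (Φ : PlanarSkeletonFrmQuasi G) (t : V) (p : unitInterval) (D : Skelφ.StepI.DataNS V) (mk : ℕ) (g : ℕ) (f : ℕ) (qxY : ℕ) (WxY : ℕ) (c : Fin 2 → ℕ) (hN : EqNumL κ Φ t p D g f) (hg : gFloorKG κ Φ t p D mk ≤ g) (hg2 : 40 * Neg.K κ * KS0.R'0N κ Φ (KS.NQ Φ) t p D mk ≤ g)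
    (hf : KS.fxR0 κ Φ t p D mk ≤ f) (hWxY : KS.Rs t D mk + 34 * nL κ Φ t p D g f + 29 * KS0.R'0N κ Φ (KS.NQ Φ) t p D mk + 2 ≤ WxY) (hWx : WxY ≤ 100 * nL κ Φ t p D g f)
    (b : Fin 2 → ℕ) {lo hi : Site 2}
    (hlo0 : lo 0 ≤ ((kgYRows0_of κ Φ t p D g f mk qxY WxY hN hg).kgLastLoY (kgNYv0 κ Φ t p D g f mk qxY WxY)) 0 - 2 * (nL κ Φ t p D g f : ℤ))
    (hhi0 : ((kgYRows0_of κ Φ t p D g f mk qxY WxY hN hg).kgLastHiY (kgNYv0 κ Φ t p D g f mk qxY WxY)) 0 + (nL κ Φ t p D g f : ℤ) ≤ hi 0)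
    (hlo1 : lo 1 ≤ ((kgYRows0_of κ Φ t p D g f mk qxY WxY hN hg).kgLastLoY (kgNYv0 κ Φ t p D g f mk qxY WxY)) 1 - (kgSL (nL κ Φ t p D g f) (ℓL κ Φ t p D g f) (hL κ Φ t p D g f)))
    (hhi1 : ((kgYRows0_of κ Φ t p D g f mk qxY WxY hN hg).kgLastHiY (kgNYv0 κ Φ t p D g f mk qxY WxY)) 1 + 1 ≤ hi 1)
    (hrow : ((fcellsT κ Φ t p D g f c).c 1 : ℤ) - (b 0 : ℤ) + 1 ≤ rdLo (Aof κ) (nL κ Φ t p D g f) (hL κ Φ t p D g f) (vL κ Φ t p D g f) (vβL κ Φ t p D g f) (prFA κ Φ t p D g f).c₀ (prFA κ Φ t p D g f).c₁ (prFA κ Φ t p D g f).D lo hi 0 ∧ rdHi (Aof κ) (nL κ Φ t p D g f) (hL κ Φ t p D g f) (vL κ Φ t p D g f) (vβL κ Φ t p D g f) (prFA κ Φ t p D g f).c₀ (prFA κ Φ t p D g f).c₁ (prFA κ Φ t p D g f).D lo hi 0 ≤ ((fcellsT κ Φ t p D g f c).c 1 : ℤ) + (b 0 : ℤ) - 1 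∧
      20 * (((fcellsA κ Φ t p D g f).r 1 : ℕ) : ℤ) - (b 1 : ℤ) + 1 ≤ rdLo (Aof κ) (nL κ Φ t p D g f) (hL κ Φ t p D g f) (vL κ Φ t p D g f) (vβL κ Φ t p D g f) (prFA κ Φ t p D g f).c₀ (prFA κ Φ t p D g f).c₁ (prFA κ Φ t p D g f).D lo hi 1 ∧ rdHi (Aof κ) (nL κ Φ t p D g f) (hL κ Φ t p D g f) (vL κ Φ t p D g f) (vβL κ Φ t p D g f) (prFA κ Φ t p D g f).c₀ (prFA κ Φ t p D g f).c₁ (prFA κ Φ t p D g f).D lo hi 1 ≤ 20 * (((fcellsA κ Φ t p D g f).r 1 : ℕ) : ℤ) + (b 1 : ℤ) - 1)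
    {φ' : V → Site 2} {c₂ : V} (hX : φ' c₂ 0 - φ' t 0 = (((KS.X2R κ Φ t p D mk g f WxY) : ℕ) : ℤ)) (hY : φ' c₂ 1 - φ' t 1 = (KS.Y2R κ Φ t p D mk g f WxY)) :
    ∀ w : V, Skelφ.runX φ' c₂ (nL κ Φ t p D g f) (hL κ Φ t p D g f) 1 w ∈ ScheduleNP.core (Skelφ.kgCorrSchedY (kgYRows0_of κ Φ t p D g f mk qxY (KS.WxYR κ Φ t p D mk g f WxY) hN hg).hn (kgYRows0_of κ Φ t p D g f mk qxY (KS.WxYR κ Φ t p D mk g f WxY) hN hg).hv (kgYRows0_of κ Φ t p D g f mk qxY (KS.WxYR κ Φ t p D mk g f WxY) hN hg).hlay ((kgYRows0_of κ Φ t p D g f mk qxY (KS.WxYR κ Φ t p D mk g f WxY) hN hg).kgYVals_ok₁ (kgNYv0 κ Φ t p D g f mk qxY WxY)) ((kgYRows0_of κ Φ t p D g f mk qxY (KS.WxYR κ Φ t p D mk g f WxY) hN hg).kgYVals_ok₂ (kgNYv0 κ Φ t p D g f mk qxY WxY)) ((kgYRows0_of κ Φ t p D g f mk qxY (KS.WxYR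 κ Φ t p D mk g f WxY) hN hg).kgYVals_split (kgNYv0 κ Φ t p D g f mk qxY WxY))) ((Skelφ.kgCorrSchedY (kgYRows0_of κ Φ t p D g f mk qxY (KS.WxYR κ Φ t p D mk g f WxY) hN hg).hn (kgYRows0_of κ Φ t p D g f mk qxY (KS.WxYR κ Φ t p D mk g f WxY) hN hg).hv (kgYRows0_of κ Φ t p D g f mk qxY (KS.WxYR κ Φ t p D mk g f WxY) hN hg).hlay ((kgYRows0_of κ Φ t p D g f mk qxY (KS.WxYR κ Φ t p D mk g f WxY) hN hg).kgYVals_ok₁ (kgNYv0 κ Φ t p D g f mk qxY WxY)) ((kgYRows0_of κ Φ t p D g f mk qxY (KS.WxYR κ Φ t p D mk g f WxY) hN hg).kgYVals_ok₂ (kgNYv0 κ Φ t p D g f mk qxY WxY)) ((kgYRows0_of κ Φ t p D g f mk qxY (KS.WxYR κ Φ t p D mk g f WxY) hN hg).kgYVals_split (kgNYv0 κ Φ t p D g f mk qxY WxY))).N + 1) →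
      TargetFootT (fcellsT κ Φ t p D g f c) b (((1 : Fin 2), true) : MDir) (fineA κ Φ t p D g f φ' w) := by
  intro w hw
  have hb := yLast_mem_box κ Φ t p D mk g f qxY WxY hN hg hg2 hf hWxY hWx hX hY hlo0 hhi0 hlo1 hhi1 hw
  have h0 := fine_mem_rd_root κ Φ t p D g f hN hb 0
  have h1 := fine_mem_rd_root κ Φ t p D g f hN hb 1
  obtain ⟨hl0, hu0, hl1, hu1⟩ := hrow
  exact targetFootT_snd_of_bounds (fcellsT κ Φ t p D g f c) b (by rw [fcellsT_r]; linarith [h1.1]) (by rw [fcellsT_r]; linarith [h1.2])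
    (by linarith [h0.1]) (by linarith [h0.2])

end ReadY

end KS

end NegB

end PlanarSkeletonFrmQuasi

end Summit.CriticalPhenomena.PercolationContinuityZ3.Theorems.Transplant

end
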